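import Summits.Ventures.HSemireg.WedgeHankelRecurrenceKernel
import Summits.Ventures.HSemireg.WedgeHankelRecurrenceModuli

/-!
# Venture HSemireg — TORELLI FOR THE KERNEL OF A CLASS: for two classes of the same middle rank `r`, **`Kr(univ, w_N(q), k) = Kr(univ, w_N(q′), k) ↔ Rec_r(q) = Rec_r(q′)`** for
# every degree `k` in the window `r ≤ k`, `k + r ≤ N + 1`, `k ≤ N` — the degree-`k` kernel of a rank-`r` class is the SAME DATUM as its minimal-recurrence line `K · m ⊆ K[X]_{≤ r}`; with
# N26 (every line occurs) the degree-`k` kernels of the rank-`r` classes are parametrised exactly by `P(K[X]_{≤ r}) ≅ P^r = Sym^r(P¹)`, for every `k` in the window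

HONEST FRAMING. Part of the Lean index of the computation cell `pub-hsemireg` (seat p10 gen 26, Sunday typer «UNIFORM-IN-n»).
LINEAR ALGEBRA OF HANKEL (catalecticant) MATRICES and of polynomials over a field + (through the cited tree theorems) finite-dimensional EXTERIOR ALGEBRA ONLY: no variety, no cohomology
theory, no sheaf, no Ext group and no semiregularity map is constructed here; nothing here says that HC / HC_CM / HC_AV holds; no Literature fact is declared or used.  Custodian versions
as in `WedgeHankelSiegelIdeal` (1/3); the dictionary (`Kr(univ, w_N(q), k)` = the degree-`k` kernel of `θ ↦ θ ∧ w_N(q)`; «Torelli»: the kernel remembers the class up to the fibre of the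
period map; `Sym^r(P¹)` = effective divisors of degree `r`) is QUOTED, never asserted.

WHAT IS IN THE TREE / KEYED.  N18 (`WedgeHankelRecurrenceModule`, № 173): `recSpace`, `exists_recSpace_self_eq_span`, `recSpace_eq_map_mulRight`, `mem_degreeLT_succ_iff`; N21
(`WedgeHankelRecurrenceKernel`, p10 g26 claim #4): `Kr_w_eq_Kr_w_iff_recSpace_eq`, `V_w_eq_V_w_iff_recSpace_eq`; N26 (`WedgeHankelRecurrenceModuli`, № 179): `exists_rank_half_eq_and_recSpace_eq_span`
(the period map is onto).  Mathlib: `Polynomial.isUnit_iff`, `Submodule.span_singleton_smul_eq`.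
THIS FILE (namespace `Summit.Ventures.HSemireg.Wedge.HankelOuter` continued; CHAINED on N21 and N26; 0 definitions):
* §495 `map_mulRight_smul_degreeLT` (a unit scalar on the generator changes nothing), **`span_eq_of_map_mulRight_degreeLT_eq`** (`m · K[X]_{≤d} = m′ · K[X]_{≤d}`, `m ≠ 0 ⇒ K · m = K · m′`).
* §496 **`recSpace_add_eq_iff_recSpace_self_eq`** (`R(q) = R(q′) = r`, `2r + d ≤ N + 1`: `Rec_{r+d}(q) = Rec_{r+d}(q′) ↔ Rec_r(q) = Rec_r(q′)` — one window of the module determines the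
  minimal recurrence).
* §497 TORELLI: **`Kr_w_eq_Kr_w_iff_recSpace_self_eq`** (`R(q) = R(q′) = r`, `2r + d ≤ N + 1`, `r + d ≤ N`: `Kr(univ, w_N q, r+d) = Kr(univ, w_N q′, r+d) ↔ Rec_r(q) = Rec_r(q′)`),
  `V_w_eq_V_w_iff_recSpace_self_eq` (mirror images), **`Kr_w_eq_iff_forall_window`** (equal kernels in ONE degree of the window ⇔ in ALL of them), and the summary
  **`kernels_of_rank_parametrised`** (`r ≤ k`, `k + r ≤ N + 1`, `k ≤ N`: every line `K · p₀`, `p₀ ≠ 0`, `deg p₀ ≤ r`, is the line of some rank-`r` class, and two rank-`r` classes have equal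
  degree-`k` kernels iff equal lines).
READING: THEOREM H gave the SIZE of `Kr(univ, w_N(q), k)` from `rank H_k(q)`; N15/N16 said the size row is a trapezoid labelled by `r = R(q)`; this file with N21/N26 says WHICH kernels
occur for a given `r`: throughout the window they are in canonical bijection with `P(K[X]_{≤ r}) = Sym^r(P¹)` via the minimal recurrence (N19/N20: the divisor classes sit at the split
divisors; N22/N24: the substitution group acts as on binary `r`-forms).  Outside the window (`k < r` or `k > N + 1 − r`) the kernel carries less (N18's sharpness).  Nothing Ext-side.
New names only.
-/

open Module Polynomial
open scoped Matrix Polynomial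

namespace Summit.Ventures.HSemireg.Wedge.HankelOuter

open Summit.Ventures.HSemireg.Wedge Summit.Ventures.HSemireg.Wedge.Kunneth Summit.Ventures.HSemireg.Wedge.Hankel
  Summit.Ventures.HSemireg.Wedge.BasisFree Summit.Ventures.HSemireg.Wedge.HankelSiegel Summit.Ventures.HSemireg.Wedge.HankelSiegelIdeal
  Summit.Ventures.HSemireg.Wedge.KunnethKernel Summit.Ventures.HSemireg.Wedge.HankelFrameChange Summit.Ventures.HSemireg.Wedge.KernelDuality

variable (K : Type*) [Field K] {N : ℕ}

/-! ## §495. The generator of `m · K[X]_{≤ d}` is determined up to a scalar -/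

/-- scaling the generator by a unit does not change the module of multiples. -/
theorem map_mulRight_smul_degreeLT {c : K} (hc : c ≠ 0) (m : K[X]) (n : ℕ) :
    (Polynomial.degreeLT K n).map (LinearMap.mulRight K (c • m)) = (Polynomial.degreeLT K n).map (LinearMap.mulRight K m) := by
  ext p
  simp only [Submodule.mem_map, LinearMap.mulRight_apply]
  constructor
  · rintro ⟨g, hg, rfl⟩
    exact ⟨c • g, Submodule.smul_mem _ _ hg, by rw [smul_mul_assoc, mul_smul_comm]⟩
  · rintro ⟨g, hg, rfl⟩
    exact ⟨c⁻¹ • g, Submodule.smul_mem _ _ hg, by rw [smul_mul_assoc, mul_smul_comm, smul_smul, inv_mul_cancel₀ hc, one_smul]⟩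

/-- **`m · K[X]_{≤ d} = m′ · K[X]_{≤ d}` (`m ≠ 0`) forces `K · m = K · m′`**: each divides the other with quotients of degree `≤ d`, so the quotients are inverse constants. -/
theorem span_eq_of_map_mulRight_degreeLT_eq {m m' : K[X]} (hm : m ≠ 0) {d : ℕ}
    (h : (Polynomial.degreeLT K (d + 1)).map (LinearMap.mulRight K m) = (Polynomial.degreeLT K (d + 1)).map (LinearMap.mulRight K m')) : K ∙ m = K ∙ m' := by
  have h1 : m ∈ (Polynomial.degreeLT K (d + 1)).map (LinearMap.mulRight K m') := by
    rw [← h]; exact ⟨1, (mem_degreeLT_succ_iff K).mpr (by rw [Polynomial.natDegree_one]; exact Nat.zero_le d), by rw [LinearMap.mulRight_apply, one_mul]⟩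
  have h2 : m' ∈ (Polynomial.degreeLT K (d + 1)).map (LinearMap.mulRight K m) := by
    rw [h]; exact ⟨1, (mem_degreeLT_succ_iff K).mpr (by rw [Polynomial.natDegree_one]; exact Nat.zero_le d), by rw [LinearMap.mulRight_apply, one_mul]⟩
  obtain ⟨g, -, hg⟩ := h1
  obtain ⟨g', -, hg'⟩ := h2
  rw [LinearMap.mulRight_apply] at hg hg'
  -- `m = g m'`, `m' = g' m` ⇒ `g g' = 1`
  have hgg : g * g' = 1 := by
    have e : g * g' * m = 1 * m := by rw [one_mul, mul_assoc, hg', hg]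
    exact mul_right_cancel₀ hm e
  have hgu : IsUnit g := IsUnit.of_mul_eq_one _ hgg
  obtain ⟨c, hc0, hgc⟩ : ∃ c : K, c ≠ 0 ∧ g = Polynomial.C c := by
    obtain ⟨c, hc⟩ := Polynomial.isUnit_iff.mp hgu
    exact ⟨c, hc.1.ne_zero, hc.2.symm⟩
  rw [← hg, hgc, Polynomial.C_mul']
  exact Submodule.span_singleton_smul_eq (IsUnit.mk0 c hc0) m'

/-! ## §496. Torelli for recurrences: inside the window one window determines the minimal recurrence -/

/-- **for two classes of the same middle rank `r` and `2r + d ≤ N + 1`: `Rec_{r+d}(q) = Rec_{r+d}(q′) ↔ Rec_r(q) = Rec_r(q′)`** — any one window of the module determines the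
minimal recurrence (and conversely). -/
theorem recSpace_add_eq_iff_recSpace_self_eq {r d : ℕ} {q q' : ℕ → K} (hq : (hankel1 K N (N / 2) q).rank = r) (hq' : (hankel1 K N (N / 2) q').rank = r)
    (hd : r + d + r ≤ N + 1) : recSpace K N q (r + d) = recSpace K N q' (r + d) ↔ recSpace K N q r = recSpace K N q' r := by
  obtain ⟨m, hm0, hm⟩ := exists_recSpace_self_eq_span K hq (by omega)
  obtain ⟨m', hm0', hm'⟩ := exists_recSpace_self_eq_span K hq' (by omega)
  have hmem : m ∈ recSpace K N q r := by rw [hm]; exact Submodule.mem_span_singleton_self m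
  have hmem' : m' ∈ recSpace K N q' r := by rw [hm']; exact Submodule.mem_span_singleton_self m'
  rw [recSpace_eq_map_mulRight K hq hd hmem hm0, recSpace_eq_map_mulRight K hq' hd hmem' hm0', hm, hm']
  constructor
  · exact span_eq_of_map_mulRight_degreeLT_eq K hm0
  · intro h
    obtain ⟨c, rfl⟩ := Submodule.mem_span_singleton.mp (show m' ∈ K ∙ m by rw [h]; exact Submodule.mem_span_singleton_self m')
    have hc : c ≠ 0 := by rintro rfl; exact hm0' (zero_smul _ _)
    rw [map_mulRight_smul_degreeLT K hc]

/-! ## §497. TORELLI FOR KERNELS: in the window the degree-`k` kernel of a rank-`r` class is the same datum as its minimal recurrence -/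

/-- **for two classes of the same middle rank `r`, `2r + d ≤ N + 1` and `r + d ≤ N`: `Kr(univ, w_N(q), r + d) = Kr(univ, w_N(q′), r + d) ↔ Rec_r(q) = Rec_r(q′)`** — the degree-`(r+d)`
kernel determines and is determined by the minimal-recurrence line; with N26 these lines fill `P(K[X]_{≤ r})`, so the degree-`k` kernels of the rank-`r` classes are parametrised by
`P^r = Sym^r(P¹)` for every `k` in the window. -/
theorem Kr_w_eq_Kr_w_iff_recSpace_self_eq {r d : ℕ} {q q' : ℕ → K} (hq : (hankel1 K N (N / 2) q).rank = r) (hq' : (hankel1 K N (N / 2) q').rank = r)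
    (hd : r + d + r ≤ N + 1) (hk : r + d ≤ N) :
    Kr K (Finset.univ : Finset (In N)) (w K N N q) (r + d) = Kr K (Finset.univ : Finset (In N)) (w K N N q') (r + d) ↔ recSpace K N q r = recSpace K N q' r := by
  rw [Kr_w_eq_Kr_w_iff_recSpace_eq K hk, recSpace_add_eq_iff_recSpace_self_eq K hq hq' hd]

/-- the mirror images: `V(univ, w_N(q), k′) = V(univ, w_N(q′), k′) ↔ Rec_r(q) = Rec_r(q′)` for `(r + d) + k′ = N`, `2r + d ≤ N + 1`. -/
theorem V_w_eq_V_w_iff_recSpace_self_eq {r d k' : ℕ} {q q' : ℕ → K} (hq : (hankel1 K N (N / 2) q).rank = r) (hq' : (hankel1 K N (N / 2) q').rank = r)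
    (hd : r + d + r ≤ N + 1) (hkk' : r + d + k' = N) :
    V K (In N) Finset.univ (w K N N q) k' = V K (In N) Finset.univ (w K N N q') k' ↔ recSpace K N q r = recSpace K N q' r := by
  rw [V_w_eq_V_w_iff_recSpace_eq K hkk', recSpace_add_eq_iff_recSpace_self_eq K hq hq' hd]

/-- all windows at once: **two classes of the same middle rank `r` have the same kernel in ONE degree of the window `[r, N + 1 − r] ∩ [0, N]` iff they have the same kernels in ALL
of them** (each is the minimal-recurrence line). -/
theorem Kr_w_eq_iff_forall_window {r k₀ : ℕ} {q q' : ℕ → K} (hq : (hankel1 K N (N / 2) q).rank = r) (hq' : (hankel1 K N (N / 2) q').rank = r)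
    (hrk₀ : r ≤ k₀) (hk₀ : k₀ + r ≤ N + 1) (hk₀N : k₀ ≤ N) :
    Kr K (Finset.univ : Finset (In N)) (w K N N q) k₀ = Kr K (Finset.univ : Finset (In N)) (w K N N q') k₀
      ↔ ∀ k, r ≤ k → k + r ≤ N + 1 → k ≤ N → Kr K (Finset.univ : Finset (In N)) (w K N N q) k = Kr K (Finset.univ : Finset (In N)) (w K N N q') k := by
  obtain ⟨d₀, rfl⟩ := Nat.exists_eq_add_of_le hrk₀
  rw [Kr_w_eq_Kr_w_iff_recSpace_self_eq K hq hq' (by omega) hk₀N]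
  constructor
  · intro h k hrk hkr hkN
    obtain ⟨d, rfl⟩ := Nat.exists_eq_add_of_le hrk
    exact (Kr_w_eq_Kr_w_iff_recSpace_self_eq K hq hq' (by omega) hkN).mpr h
  · intro h
    exact (Kr_w_eq_Kr_w_iff_recSpace_self_eq K hq hq' (by omega) hk₀N).mp (h (r + d₀) (by omega) hk₀ hk₀N)

/-- **THE KERNELS OF THE RANK-`r` CLASSES ARE PARAMETRISED BY `P(K[X]_{≤ r})`: for `r ≤ k`, `k + r ≤ N + 1`, `k ≤ N`, every non-zero `p₀` of degree `≤ r` is realised —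
some class `q` with `R(q) = r` and `Rec_r(q) = K · p₀` — and two rank-`r` classes have the same degree-`k` kernel iff their lines agree** (N26 + Torelli). -/
theorem kernels_of_rank_parametrised {r k : ℕ} (hrk : r ≤ k) (hkr : k + r ≤ N + 1) (hkN : k ≤ N) :
    (∀ p₀ : K[X], p₀ ≠ 0 → p₀.natDegree ≤ r → ∃ q : ℕ → K, (hankel1 K N (N / 2) q).rank = r ∧ recSpace K N q r = K ∙ p₀)
      ∧ ∀ q q' : ℕ → K, (hankel1 K N (N / 2) q).rank = r → (hankel1 K N (N / 2) q').rank = r →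
        (Kr K (Finset.univ : Finset (In N)) (w K N N q) k = Kr K (Finset.univ : Finset (In N)) (w K N N q') k ↔ recSpace K N q r = recSpace K N q' r) := by
  obtain ⟨d, rfl⟩ := Nat.exists_eq_add_of_le hrk
  exact ⟨fun p₀ hp₀ hdeg => exists_rank_half_eq_and_recSpace_eq_span K (by omega) hp₀ hdeg,
    fun q q' hq hq' => Kr_w_eq_Kr_w_iff_recSpace_self_eq K hq hq' (by omega) hkN⟩

end Summit.Ventures.HSemireg.Wedge.HankelOuter
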